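import Literature.Topology.FourManifolds.SlideDictionary
import Literature.Topology.FourManifolds.KirbyMovesSlideSweepPillbox
import HarnessLib

/-!
# The sweep of the slide in the surgered tube: planar sweep about the axis, bump on the circle, pillbox

Topic `Literature/Topology/FourManifolds`; fact seat `provefact-IsStrictHandleSlide.isSurgery`
(R. C. Kirby, *The Topology of 4-Manifolds*, LNM 1374 (1989), Ch. I §4, Figs. 4.2–4.3, §5
Thm. 5.1 (1); remaining content: the named fact (S)
`Literature.Topology.FourManifolds.FramedLink.IsStrictHandleSlide.slideModel`).
Given a surgered-tube chart `Ψ` (`exists_surgeredTube`), an axis angle `φ`, a twist `c`, a tip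
height `Y`, a margin `m`, graphs `g₁, g₂` as produced by `exists_slideGraphs`, and an aperture
`γ ∈ (0, π)`, we build **the sweep** `Σ` of the surgered manifold (`exists_slideSweepIsotopy`): the
rotated planar sweep (`exists_planarSweep_rot`) driven along the tube by a smooth bump `β` on
the circle of meridian directions which is `1` at the page direction `v₀` and vanishes at the
directions making an angle `≥ γ` with it (`exists_circleBump`), through `exists_pillboxSweep`.
We list the clauses consumed by the range bookkeeping of the slide: `Σ` is the identity off the
range of `Ψ`, on the meridian slices of directions off the aperture, on the planar points of norm
`≥ ρ + m`, and — at all times — on the untwisted half planes `{|y| ≥ Y}`; on the page it carries the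
arc `Λφ (g₂ y, y)` to `Λφ (g₁ y, y)`, `|y| ≤ Y`, where `Λφ = Rot_φ ∘ Λ⁻¹` untwists
(`hΛ`: the explicit formula) and preserves norms.

## References

* R. C. Kirby, *The Topology of 4-Manifolds*, LNM 1374, Springer (1989), Ch. I §4, §5 Thm. 5.1. [Kirby1989]
* M. W. Hirsch, *Differential Topology*, GTM 33, Springer (1976), Ch. 8 §1. [HirschDT1976]
-/

open scoped Manifold ContDiff Topology RealInnerProductSpace
open Function Set Metric Real

noncomputable section

namespace Literature.Topology.FourManifolds

/-- Local notation: `𝔼 n` is the model Euclidean space. -/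
local notation "𝔼 " n:arg => EuclideanSpace ℝ (Fin n)
/-- Local notation: `𝕊 n` is the unit sphere in `𝔼 (n+1)`. -/
local notation "𝕊 " n:arg => (Metric.sphere (0 : EuclideanSpace ℝ (Fin (n + 1))) 1)

namespace SlideSweep

/-! ### A bump on the circle of meridian directions -/

/-- **A smooth bump on the circle**, `1` near `v₀`, `0` at the directions at angle `≥ γ` from `v₀`
(measured by the inner product: `⟪v, v₀⟫ ≤ cos γ`). [folklore] -/
theorem exists_circleBump {γ : ℝ} (hγ : 0 < γ) (hγπ : γ < π) :
    ∃ β : 𝕊 1 → ℝ, ContMDiff (𝓡 1) 𝓘(ℝ, ℝ) ∞ β ∧ β v₀ = 1 ∧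
      (∀ v : 𝕊 1, Real.cos (γ / 2) ≤ ⟪(v : 𝔼 2), ((v₀ : 𝕊 1) : 𝔼 2)⟫ → β v = 1) ∧
      (∀ v : 𝕊 1, ⟪(v : 𝔼 2), ((v₀ : 𝕊 1) : 𝔼 2)⟫ ≤ Real.cos γ → β v = 0) := by
  have hcos : Real.cos γ < Real.cos (γ / 2) :=
    Real.cos_lt_cos_of_nonneg_of_le_pi (by linarith) hγπ.le (by linarith)
  set d : ℝ := Real.cos (γ / 2) - Real.cos γ with hd
  have hdpos : 0 < d := by rw [hd]; linarith
  -- the ambient smooth function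
  set f : 𝔼 2 → ℝ := fun z ↦ Real.smoothTransition ((⟪z, ((v₀ : 𝕊 1) : 𝔼 2)⟫ - Real.cos γ) / d) with hf
  have hfs : ContDiff ℝ ∞ f :=
    Real.smoothTransition.contDiff.comp (((contDiff_id.inner ℝ contDiff_const).sub contDiff_const).div_const d)
  haveI : Fact (Module.finrank ℝ (𝔼 2) = 1 + 1) := ⟨by simp⟩
  refine ⟨fun v ↦ f v, hfs.contMDiff.comp contMDiff_coe_sphere, ?_, fun v hv ↦ ?_, fun v hv ↦ ?_⟩
  · show Real.smoothTransition ((⟪((v₀ : 𝕊 1) : 𝔼 2), ((v₀ : 𝕊 1) : 𝔼 2)⟫ - Real.cos γ) / d) = 1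
    apply Real.smoothTransition.one_of_one_le
    rw [real_inner_self_eq_norm_sq, norm_eq_of_mem_sphere, one_pow, le_div_iff₀ hdpos, one_mul, hd]
    linarith [Real.cos_le_one (γ / 2)]
  · show Real.smoothTransition ((⟪(v : 𝔼 2), ((v₀ : 𝕊 1) : 𝔼 2)⟫ - Real.cos γ) / d) = 1
    apply Real.smoothTransition.one_of_one_le
    rw [le_div_iff₀ hdpos, one_mul, hd]; linarith
  · show Real.smoothTransition ((⟪(v : 𝔼 2), ((v₀ : 𝕊 1) : 𝔼 2)⟫ - Real.cos γ) / d) = 0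
    apply Real.smoothTransition.zero_of_nonpos
    exact div_nonpos_of_nonpos_of_nonneg (by linarith) hdpos.le

/-! ### The sweep -/

variable {X : Type*} [TopologicalSpace X] [ChartedSpace (𝔼 3) X] [T2Space X] [IsManifold (𝓡 3) ∞ X]

/-- **The sweep of the slide in the surgered tube.** See the module docstring.
[cite: Kirby1989, Ch. I §4] -/
theorem exists_slideSweepIsotopy {core : 𝕊 1 → X} (Ψ : TubeNbhd (𝓡 3) core)
    (φ c : ℝ) {Y ρ m : ℝ} (hY : 0 ≤ Y) (hYρ : Y ≤ ρ) (hm : 0 < m) {g₁ g₂ : ℝ → ℝ}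
    (hg₁ : ContDiff ℝ ∞ g₁) (hg₂ : ContDiff ℝ ∞ g₂) (heq : ∀ y, Y ≤ |y| → g₁ y = g₂ y)
    (hbound : ∀ y, |y| ≤ Y → ∀ θ ∈ Icc (0 : ℝ) 1, (g₂ y + θ * (g₁ y - g₂ y)) ^ 2 + y ^ 2 ≤ ρ ^ 2)
    {γ : ℝ} (hγ : 0 < γ) (hγπ : γ < π) :
    ∃ (Λ : (𝔼 2) ≃ₘ⟮𝓘(ℝ, 𝔼 2), 𝓘(ℝ, 𝔼 2)⟯ (𝔼 2)) (S : AmbientIsotopy (𝓡 3) X),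
      -- the untwisting formula and norm preservation of `Λ⁻¹`
      (∀ (r a b : ℝ), 0 ≤ r → r ≤ ρ + 2 * m → a ^ 2 + b ^ 2 = 1 →
        Λ.symm (pl (r * a) (r * b)) =
          pl (r * (((1 + a) - Real.exp (-(c * r)) ^ 2 * (1 - a)) / ((1 + a) + Real.exp (-(c * r)) ^ 2 * (1 - a))))
            (r * (2 * Real.exp (-(c * r)) * b / ((1 + a) + Real.exp (-(c * r)) ^ 2 * (1 - a))))) ∧
      (∀ z : 𝔼 2, ‖z‖ ≤ ρ + 2 * m → ‖Λ.symm z‖ = ‖z‖) ∧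
      -- identity clauses
      (∀ t (y : X), y ∉ range Ψ.toFun → S.toFun t y = y) ∧
      (∀ t (v : 𝕊 1) (p : 𝔼 2), ⟪(v : 𝔼 2), ((v₀ : 𝕊 1) : 𝔼 2)⟫ ≤ Real.cos γ → S.toFun t (Ψ.toFun (v, p)) = Ψ.toFun (v, p)) ∧
      (∀ t (v : 𝕊 1) (p : 𝔼 2), ρ + m ≤ ‖p‖ → S.toFun t (Ψ.toFun (v, p)) = Ψ.toFun (v, p)) ∧
      (∀ t (v : 𝕊 1) (w : 𝔼 2), Y ≤ |w 1| → S.toFun t (Ψ.toFun (v, planeRot φ (Λ.symm w))) = Ψ.toFun (v, planeRot φ (Λ.symm w))) ∧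
      -- the page: the arc of `g₂` is carried onto the arc of `g₁`
      (∀ y : ℝ, |y| ≤ Y → S.toFun 1 (Ψ.toFun (v₀, planeRot φ (Λ.symm (pl (g₂ y) y)))) =
        Ψ.toFun (v₀, planeRot φ (Λ.symm (pl (g₁ y) y)))) := by
  obtain ⟨Λ, σ, hΛ, hnorm, hstat, hmove, hfix⟩ := exists_planarSweep_rot φ c hY hYρ hm hg₁ hg₂ heq hbound
  obtain ⟨β, hβ, hβ₀, -, hβzero⟩ := exists_circleBump hγ hγπ
  obtain ⟨S, hS, hSoff⟩ := exists_pillboxSweep Ψ σ hstat hβ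
  refine ⟨Λ, S, hΛ, hnorm, hSoff, fun t v p hv ↦ ?_, fun t v p hp ↦ ?_, fun t v w hw ↦ ?_, fun y hy ↦ ?_⟩
  · rw [hS, hβzero v hv, mul_zero, σ.map_zero]; rfl
  · rw [hS, hstat _ p hp]
  · rw [hS, hfix w hw]
  · rw [hS, hβ₀, mul_one, hmove y hy]

end SlideSweep

end Literature.Topology.FourManifolds
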